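import Mathlib
import HarnessLib
import Summits.Ventures.LatticeQCDFlow.Exactness.NCMCGeneralSpaceOccupancyChainDoeblinMirror
import Summits.Ventures.LatticeQCDFlow.Exactness.NCMCGeneralSpaceOccupancyChainEveryStart
import Summits.Ventures.LatticeQCDFlow.Exactness.NCMCGeneralSpaceOccupancyChainErrorBars
import Summits.Ventures.LatticeQCDFlow.Exactness.NCMCGeneralSpaceOccupancyChainHeatBath

/-!
# End to end: the NCMC chain with heat-bath sweeps converges from EVERY initial configuration and carries certified error bars — for every `c ≠ ΔF`, and at `c = ΔF` whenever the work fluctuates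

HONEST FRAMING: exact (Metropolis-corrected) sampling algorithms for lattice gauge theory;
figures of merit are autocorrelation/cost numbers at stated couplings and volumes; no
continuum-physics claim.

Venture `LatticeQCDFlow` (cell pub-lqcd), topic `Exactness`; FANOUT row 13 (`eng-snf`, GEN-18).
NEW WORK of the cell, not a published result; no definition is introduced; nothing is cited as a
fact.  ASSEMBLY of GEN-18's chain (`…OccupancyChainDoeblin` → `…Mixing` → `…EveryStart`,
`…ErrorBars`, `…DoeblinMirror`) with row 9's heat-bath theorems (`HeatBathSweepErgodic.lean`:
`heatBathSweep_minorised` — the sweep dominates `(m/M)^{|l|} • ⊗μ` from every configuration) in the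
setting of GEN-17's `NCMCGeneralSpaceOccupancyChainHeatBath.lean` (THE DEFECT / BOUNDARY-CONDITION
SHAPE of `latflow-snf`'s `run_ncmc_chain`: prior weight `p₀ · ⊗μ`, target weight `p₁ · ⊗μ`, two bounded
densities against one product reference, heat-bath scans as the level samplers between switches).
GEN-17 gave: ergodic, consistent from `π_c` and from almost every start.  GEN-18 gives, with NO
hypothesis on the protocol beyond the Crooks pair when `c ≠ ΔF` (and "the forward work is not almost
surely `c`" when `c = ΔF`): convergence from EVERY start, `π_c` the unique invariant law, and explicit
(Doeblin-quality) burn-in, variance and deviation bounds for `p̂_n` and `dF_occ`.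

## Content

* §1 from an EXISTENTIAL two-step certificate (`∃ ε ≠ 0, ν, ε • ν ≤ nHit Q 2 z`, as produced by
  `CrooksPair.ncmc_exists_sq_doeblin`): **`CrooksPair.ncmc_everyStart_of_exists_sq`** (from every
  initial state `p̂_n → σ(c − ΔF)` and `dF_occ,n → ΔF` a.s.), **`CrooksPair.ncmc_errorBars_of_exists_sq`**
  (`∃ ε ∈ (0, 1]`: burn-in `|E_{μ₀} p̂_n − σ| ≤ 2/(ε n)` from any initial law, `Var_π p̂_n ≤
  2(1/2 + (2/ε − 1)/(1 − σ)) σ(1 − σ)/n`, `P_π(|dF_occ,n − ΔF| ≥ η) ≤ that/δ_η²`).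
* §2 `heatBath_minorising` — the explicit minorising measure `(m/M)^{|l|} • ⊗μ` of a bounded-density
  heat-bath scan: finite, non-zero, below every row, and `p · ⊗μ ≪` it.
  **`CrooksPair.ncmc_heatBath_everyStart`** — THE ENGINE, END TO END: two bounded densities, heat-bath
  scans as level samplers, ANY Crooks pair, ANY `c`, the forward work not almost surely equal to `c`:
  from EVERY initial state of the expanded ensemble the occupancy fraction converges to `σ(c − ΔF)`
  and `dF_occ,n` to `ΔF` almost surely; **`CrooksPair.ncmc_heatBath_everyStart_of_ne`** — the same for
  every `c ≠ ΔF` with no work hypothesis; **`CrooksPair.ncmc_heatBath_errorBars`** — the certified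
  error bars of §1 for this sampler.

NOT CLAIMED: the value of the constant (a product of `(m/M)^{|l|}`-type numbers and rejection
masses — astronomically small; the MEASURED `τ_int` stays the figure of merit); `c = ΔF` with a
dissipation-free protocol; the Wilson-coupling and Cabibbo–Marinari instances (same assembly with
`wilson_heatBathSweep_package` / `latSweep_minorised`; next file).
-/

namespace Summit.Ventures.LatticeQCDFlow.Exactness.GeneralNCMC

open MeasureTheory ProbabilityTheory Set Filter Finset
open scoped ENNReal Topology

/-! ## §1 Consequences of an existential two-step certificate -/

section Exists

variable {Ω E : Type*} [MeasurableSpace Ω] [MeasurableSpace E]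
  {ν₀ ν₁ : Measure Ω} [IsFiniteMeasure ν₀] [IsFiniteMeasure ν₁]
  {κF κR : Kernel Ω E} [IsMarkovKernel κF] [IsMarkovKernel κR] {s e : E → Ω} {W : E → ℝ} {c : ℝ}
  {T₀ T₁ : Kernel Ω Ω} [IsMarkovKernel T₀] [IsMarkovKernel T₁]

/-- **From an existential two-step certificate: convergence from EVERY initial state** of the
occupancy fraction (to `σ(c − ΔF)`) and of `dF_occ` (to `ΔF`). -/
theorem CrooksPair.ncmc_everyStart_of_exists_sq (h : CrooksPair ν₀ ν₁ κF κR s e W)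
    (h0 : ν₀ univ ≠ 0) (h1 : ν₁ univ ≠ 0) (hT₀ : Kernel.Invariant T₀ ν₀)
    (hT₁ : Kernel.Invariant T₁ ν₁)
    (hex : ∃ (ε : ℝ≥0∞) (ν : Measure (Bool × Ω)), IsProbabilityMeasure ν ∧ ε ≠ 0 ∧
      ∀ z, ε • ν ≤ nHit (switchKernel κF κR c W s e ∘ₖ levelKernel T₀ T₁) 2 z)
    {ΔF : ℝ} (hΔF : Real.exp (-ΔF) = ((ν₀ univ)⁻¹ * ν₁ univ).toReal) (z : Bool × Ω) :
    haveI := isMarkovKernel_switchKernel (κF := κF) (κR := κR) (c := c)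
      h.measurable_W h.measurable_s h.measurable_e
    haveI := isMarkovKernel_levelKernel T₀ T₁
    ∀ᵐ x ∂(Kernel.trajMeasure (X := fun _ : ℕ => Bool × Ω) (Measure.dirac z)
        (fun n : ℕ => (switchKernel κF κR c W s e ∘ₖ levelKernel T₀ T₁).comap
          (fun hh : (j : ↥(Finset.Iic n)) → Bool × Ω => hh ⟨n, Finset.mem_Iic.2 le_rfl⟩)
          (measurable_pi_apply _))),
      Tendsto (fun n : ℕ => (∑ i ∈ range n, (targetLevel Ω).indicator (1 : Bool × Ω → ℝ) (x i)) / n)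
          atTop (𝓝 (Real.sigmoid (c - ΔF))) ∧
        Tendsto (fun n : ℕ => c - Real.log
            ((∑ i ∈ range n, (targetLevel Ω).indicator (1 : Bool × Ω → ℝ) (x i)) / n /
              (1 - (∑ i ∈ range n, (targetLevel Ω).indicator (1 : Bool × Ω → ℝ) (x i)) / n)))
          atTop (𝓝 ΔF) := by
  obtain ⟨ε, ν, hν, hε, hD⟩ := hex
  haveI := hν
  filter_upwards [h.ncmc_occupancy_everyStart_of_sq h0 h1 hT₀ hT₁ hε hD hΔF z,
    h.ncmc_dFocc_everyStart_of_sq h0 h1 hT₀ hT₁ hε hD hΔF z] with x hx1 hx2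
  exact ⟨hx1, hx2⟩

/-- **From an existential two-step certificate: certified error bars** — some `ε ∈ (0, 1]` with the
burn-in bound from any initial law, the stationary variance bound of `p̂_n`, and the deviation bound
for `dF_occ` (`σ = σ(c − ΔF)`, `δ_η = min(σ(c − ΔF + η) − σ, σ − σ(c − ΔF − η))`). -/
theorem CrooksPair.ncmc_errorBars_of_exists_sq (h : CrooksPair ν₀ ν₁ κF κR s e W)
    (h0 : ν₀ univ ≠ 0) (h1 : ν₁ univ ≠ 0) (hT₀ : Kernel.Invariant T₀ ν₀)
    (hT₁ : Kernel.Invariant T₁ ν₁)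
    (hex : ∃ (ε : ℝ≥0∞) (ν : Measure (Bool × Ω)), IsProbabilityMeasure ν ∧ ε ≠ 0 ∧
      ∀ z, ε • ν ≤ nHit (switchKernel κF κR c W s e ∘ₖ levelKernel T₀ T₁) 2 z)
    {ΔF : ℝ} (hΔF : Real.exp (-ΔF) = ((ν₀ univ)⁻¹ * ν₁ univ).toReal) :
    haveI := isMarkovKernel_switchKernel (κF := κF) (κR := κR) (c := c)
      h.measurable_W h.measurable_s h.measurable_e
    haveI := isMarkovKernel_levelKernel T₀ T₁
    ∃ ε : ℝ, 0 < ε ∧ ε ≤ 1 ∧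
      (∀ (μ₀ : Measure (Bool × Ω)) [IsProbabilityMeasure μ₀] (n : ℕ), n ≠ 0 →
        |∫ x, (∑ i ∈ range n, (targetLevel Ω).indicator (1 : Bool × Ω → ℝ) (x i)) / n
            ∂(Kernel.trajMeasure (X := fun _ : ℕ => Bool × Ω) μ₀
              (fun n : ℕ => (switchKernel κF κR c W s e ∘ₖ levelKernel T₀ T₁).comap
                (fun hh : (j : ↥(Finset.Iic n)) → Bool × Ω => hh ⟨n, Finset.mem_Iic.2 le_rfl⟩)
                (measurable_pi_apply _))) - Real.sigmoid (c - ΔF)| ≤ 2 / (ε * n)) ∧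
      (∀ n : ℕ, n ≠ 0 →
        Var[fun z : ℕ → Bool × Ω =>
            (∑ i ∈ range n, (targetLevel Ω).indicator (1 : Bool × Ω → ℝ) (z i)) / n;
          Kernel.trajMeasure (X := fun _ : ℕ => Bool × Ω)
            ((jointWeight c ν₀ ν₁ univ)⁻¹ • jointWeight c ν₀ ν₁)
            (fun n : ℕ => (switchKernel κF κR c W s e ∘ₖ levelKernel T₀ T₁).comap
              (fun hh : (j : ↥(Finset.Iic n)) → Bool × Ω => hh ⟨n, Finset.mem_Iic.2 le_rfl⟩)
              (measurable_pi_apply _))] ≤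
          2 * (1 / 2 + (2 / ε - 1) / (1 - Real.sigmoid (c - ΔF))) *
            (Real.sigmoid (c - ΔF) * (1 - Real.sigmoid (c - ΔF))) / n) ∧
      (∀ n : ℕ, n ≠ 0 → ∀ η : ℝ, 0 < η →
        Kernel.trajMeasure (X := fun _ : ℕ => Bool × Ω)
            ((jointWeight c ν₀ ν₁ univ)⁻¹ • jointWeight c ν₀ ν₁)
            (fun n : ℕ => (switchKernel κF κR c W s e ∘ₖ levelKernel T₀ T₁).comap
              (fun hh : (j : ↥(Finset.Iic n)) → Bool × Ω => hh ⟨n, Finset.mem_Iic.2 le_rfl⟩)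
              (measurable_pi_apply _))
          {z | η ≤ |c - Real.log
              ((∑ i ∈ range n, (targetLevel Ω).indicator (1 : Bool × Ω → ℝ) (z i)) / n /
                (1 - (∑ i ∈ range n, (targetLevel Ω).indicator (1 : Bool × Ω → ℝ) (z i)) / n)) -
              ΔF|} ≤
          ENNReal.ofReal (2 * (1 / 2 + (2 / ε - 1) / (1 - Real.sigmoid (c - ΔF))) *
            (Real.sigmoid (c - ΔF) * (1 - Real.sigmoid (c - ΔF))) / n /
            (min (Real.sigmoid (c - ΔF + η) - Real.sigmoid (c - ΔF))
              (Real.sigmoid (c - ΔF) - Real.sigmoid (c - ΔF - η))) ^ 2)) := by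
  haveI := isMarkovKernel_switchKernel (κF := κF) (κR := κR) (c := c)
    h.measurable_W h.measurable_s h.measurable_e
  haveI := isMarkovKernel_levelKernel T₀ T₁
  obtain ⟨ε, ν, hν, hε, hD⟩ := hex
  haveI := hν
  obtain ⟨x0, -⟩ := nonempty_of_measure_ne_zero h0
  haveI : Nonempty (Bool × Ω) := ⟨(false, x0)⟩
  haveI := isMarkovKernel_nHit (switchKernel κF κR c W s e ∘ₖ levelKernel T₀ T₁) 2
  have hε1 : ε ≤ 1 := eps_le_one_of_minorised hD
  have hεtop : ε ≠ ∞ := ne_top_of_le_ne_top ENNReal.one_ne_top hε1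
  refine ⟨ε.toReal, ENNReal.toReal_pos hε hεtop,
    ENNReal.toReal_le_of_le_ofReal zero_le_one (by simpa using hε1), ?_, ?_, ?_⟩
  · intro μ₀ _ n hn
    exact h.ncmc_occupancyAverage_bias_le_of_sq h0 h1 hT₀ hT₁ hε hD hΔF μ₀ hn
  · intro n hn
    exact h.ncmc_variance_occupancy_le_of_sq h0 h1 hT₀ hT₁ hε hD hΔF hn
  · intro n hn η hη
    exact h.ncmc_dFocc_deviation_le_of_sq h0 h1 hT₀ hT₁ hε hD hΔF hn hη

end Exists

/-! ## §2 The engine: two bounded densities, heat-bath scans between switches -/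

section HeatBath

variable {ι : Type*} [Fintype ι] [DecidableEq ι] {X : ι → Type*} [∀ i, MeasurableSpace (X i)]
variable {μ : Π i, Measure (X i)} [∀ i, IsProbabilityMeasure (μ i)]

/-- **The explicit minorising measure of a bounded-density heat-bath scan**: for a measurable joint
density `0 < m ≤ p ≤ M < ∞` and a scan over a list `l` visiting every site, `(m/M)^{|l|} • ⊗μ` is a
finite non-zero measure lying below every row of the scan, and `p · ⊗μ` is absolutely continuous with
respect to it. -/
theorem heatBath_minorising {p : (Π j, X j) → ℝ≥0∞} {m M : ℝ≥0∞} (hp : Measurable p)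
    (hm0 : m ≠ 0) (hMtop : M ≠ ∞) (hmp : ∀ ω, m ≤ p ω) (hpM : ∀ ω, p ω ≤ M) {l : List ι}
    (hl : ∀ i, i ∈ l) :
    IsFiniteMeasure ((m * M⁻¹) ^ l.length • Measure.pi μ) ∧
      ((m * M⁻¹) ^ l.length • Measure.pi μ) univ ≠ 0 ∧
      (∀ z, (m * M⁻¹) ^ l.length • Measure.pi μ ≤ cycle (l.map (siteHeatBath μ p)) z) ∧
      (Measure.pi μ).withDensity p ≪ (m * M⁻¹) ^ l.length • Measure.pi μ := by
  obtain ⟨ω, -⟩ := nonempty_of_measure_ne_zero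
    (show (Measure.pi μ) (univ : Set (Π j, X j)) ≠ 0 by rw [measure_univ]; exact one_ne_zero)
  have hmtop : m ≠ ∞ := ne_top_of_le_ne_top hMtop ((hmp ω).trans (hpM ω))
  have hM0 : M ≠ 0 := fun hM0 => hm0 (le_antisymm ((hmp ω).trans ((hpM ω).trans hM0.le)) bot_le)
  have hc_top : (m * M⁻¹) ^ l.length ≠ ∞ :=
    ENNReal.pow_ne_top (ENNReal.mul_ne_top hmtop (ENNReal.inv_ne_top.2 hM0))
  have hc0 : (m * M⁻¹) ^ l.length ≠ 0 := pow_ne_zero _ (mul_ne_zero hm0 (ENNReal.inv_ne_zero.2 hMtop))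
  refine ⟨Measure.smul_finite _ hc_top, ?_, heatBathSweep_minorised hp hm0 hMtop hmp hpM hl, ?_⟩
  · rw [Measure.smul_apply, smul_eq_mul, measure_univ, mul_one]
    exact hc0
  · refine (withDensity_absolutelyContinuous _ _).trans (Measure.AbsolutelyContinuous.mk ?_)
    intro S _ hS
    rw [Measure.smul_apply, smul_eq_mul, mul_eq_zero] at hS
    exact hS.resolve_left hc0

/-- **THE ENGINE'S NCMC CHAIN WITH HEAT-BATH SWEEPS CONVERGES FROM EVERY INITIAL CONFIGURATION.**
Prior weight `p₀ · ⊗μ`, target weight `p₁ · ⊗μ` (`0 < m_k ≤ p_k ≤ M_k < ∞`), level samplers the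
heat-bath scans for `p₀` / `p₁` over lists visiting every site, ANY Crooks pair between the two
weights, ANY `c`, and the forward work NOT almost surely equal to `c` under `(p₀ · ⊗μ) ∘ κF`: from
EVERY initial state `z` of the expanded ensemble (any configuration, either level), along the chain
of `run_ncmc_chain` started at `z`, the occupancy fraction converges to `σ(c − ΔF)` and
`dF_occ,n = c − log(p̂_n/(1 − p̂_n))` to `ΔF` almost surely. -/
theorem CrooksPair.ncmc_heatBath_everyStart {p₀ p₁ : (Π j, X j) → ℝ≥0∞} {m₀ M₀ m₁ M₁ : ℝ≥0∞}
    (hp₀ : Measurable p₀) (hm₀0 : m₀ ≠ 0) (hM₀ : M₀ ≠ ∞) (hmp₀ : ∀ ω, m₀ ≤ p₀ ω)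
    (hpM₀ : ∀ ω, p₀ ω ≤ M₀) {l₀ : List ι} (hl₀ : ∀ i, i ∈ l₀)
    (hp₁ : Measurable p₁) (hm₁0 : m₁ ≠ 0) (hM₁ : M₁ ≠ ∞) (hmp₁ : ∀ ω, m₁ ≤ p₁ ω)
    (hpM₁ : ∀ ω, p₁ ω ≤ M₁) {l₁ : List ι} (hl₁ : ∀ i, i ∈ l₁)
    {E : Type*} [MeasurableSpace E] {κF κR : Kernel (Π j, X j) E} [IsMarkovKernel κF]
    [IsMarkovKernel κR] {s e : E → Π j, X j} {W : E → ℝ}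
    (h : CrooksPair ((Measure.pi μ).withDensity p₀) ((Measure.pi μ).withDensity p₁) κF κR s e W)
    (c : ℝ) (hW : (((Measure.pi μ).withDensity p₀).bind κF) {ε | W ε ≠ c} ≠ 0) {ΔF : ℝ}
    (hΔF : Real.exp (-ΔF) = ((((Measure.pi μ).withDensity p₀) univ)⁻¹ *
      ((Measure.pi μ).withDensity p₁) univ).toReal) :
    ∃ (_ : IsMarkovKernel (switchKernel κF κR c W s e))
      (_ : IsMarkovKernel (levelKernel (cycle (l₀.map (siteHeatBath μ p₀)))
        (cycle (l₁.map (siteHeatBath μ p₁))))),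
      ∀ z : Bool × (Π j, X j), ∀ᵐ x ∂(Kernel.trajMeasure (X := fun _ : ℕ => Bool × (Π j, X j))
          (Measure.dirac z)
          (fun n : ℕ => (switchKernel κF κR c W s e ∘ₖ
            levelKernel (cycle (l₀.map (siteHeatBath μ p₀))) (cycle (l₁.map (siteHeatBath μ p₁)))).comap
            (fun hh : (j : ↥(Finset.Iic n)) → Bool × (Π j, X j) => hh ⟨n, Finset.mem_Iic.2 le_rfl⟩)
            (measurable_pi_apply _))),
        Tendsto (fun n : ℕ =>
            (∑ i ∈ range n, (targetLevel (Π j, X j)).indicator (1 : Bool × (Π j, X j) → ℝ) (x i)) / n)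
          atTop (𝓝 (Real.sigmoid (c - ΔF))) ∧
        Tendsto (fun n : ℕ => c - Real.log
            ((∑ i ∈ range n, (targetLevel (Π j, X j)).indicator (1 : Bool × (Π j, X j) → ℝ) (x i)) / n /
              (1 - (∑ i ∈ range n,
                (targetLevel (Π j, X j)).indicator (1 : Bool × (Π j, X j) → ℝ) (x i)) / n)))
          atTop (𝓝 ΔF) := by
  obtain ⟨hMk₀, hfin₀, -, -, h0, -, hK₀, -⟩ := heatBathSweep_package (μ := μ) hp₀ hm₀0
    hM₀ hmp₀ hpM₀ hl₀
  obtain ⟨hMk₁, hfin₁, -, -, h1, -, hK₁, -⟩ := heatBathSweep_package (μ := μ) hp₁ hm₁0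
    hM₁ hmp₁ hpM₁ hl₁
  obtain ⟨hmfin₀, hm₀, hmin₀, hac₀⟩ := heatBath_minorising (μ := μ) hp₀ hm₀0 hM₀ hmp₀ hpM₀ hl₀
  obtain ⟨hmfin₁, hm₁, hmin₁, hac₁⟩ := heatBath_minorising (μ := μ) hp₁ hm₁0 hM₁ hmp₁ hpM₁ hl₁
  haveI := hMk₀
  haveI := hMk₁
  haveI := hfin₀
  haveI := hfin₁
  haveI := hmfin₀
  haveI := hmfin₁
  refine ⟨isMarkovKernel_switchKernel (κF := κF) (κR := κR) (c := c)
      h.measurable_W h.measurable_s h.measurable_e, isMarkovKernel_levelKernel _ _, fun z => ?_⟩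
  exact h.ncmc_everyStart_of_exists_sq h0 h1 hK₀ hK₁
    (h.ncmc_exists_sq_doeblin hm₀ hm₁ hmin₀ hmin₁ hac₀ hac₁ c hW) hΔF z

/-- **… for EVERY `c ≠ ΔF`, with no hypothesis on the protocol beyond the Crooks pair.** -/
theorem CrooksPair.ncmc_heatBath_everyStart_of_ne {p₀ p₁ : (Π j, X j) → ℝ≥0∞}
    {m₀ M₀ m₁ M₁ : ℝ≥0∞}
    (hp₀ : Measurable p₀) (hm₀0 : m₀ ≠ 0) (hM₀ : M₀ ≠ ∞) (hmp₀ : ∀ ω, m₀ ≤ p₀ ω)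
    (hpM₀ : ∀ ω, p₀ ω ≤ M₀) {l₀ : List ι} (hl₀ : ∀ i, i ∈ l₀)
    (hp₁ : Measurable p₁) (hm₁0 : m₁ ≠ 0) (hM₁ : M₁ ≠ ∞) (hmp₁ : ∀ ω, m₁ ≤ p₁ ω)
    (hpM₁ : ∀ ω, p₁ ω ≤ M₁) {l₁ : List ι} (hl₁ : ∀ i, i ∈ l₁)
    {E : Type*} [MeasurableSpace E] {κF κR : Kernel (Π j, X j) E} [IsMarkovKernel κF]
    [IsMarkovKernel κR] {s e : E → Π j, X j} {W : E → ℝ}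
    (h : CrooksPair ((Measure.pi μ).withDensity p₀) ((Measure.pi μ).withDensity p₁) κF κR s e W)
    {c ΔF : ℝ}
    (hΔF : Real.exp (-ΔF) = ((((Measure.pi μ).withDensity p₀) univ)⁻¹ *
      ((Measure.pi μ).withDensity p₁) univ).toReal) (hc : c ≠ ΔF) :
    ∃ (_ : IsMarkovKernel (switchKernel κF κR c W s e))
      (_ : IsMarkovKernel (levelKernel (cycle (l₀.map (siteHeatBath μ p₀)))
        (cycle (l₁.map (siteHeatBath μ p₁))))),
      ∀ z : Bool × (Π j, X j), ∀ᵐ x ∂(Kernel.trajMeasure (X := fun _ : ℕ => Bool × (Π j, X j))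
          (Measure.dirac z)
          (fun n : ℕ => (switchKernel κF κR c W s e ∘ₖ
            levelKernel (cycle (l₀.map (siteHeatBath μ p₀))) (cycle (l₁.map (siteHeatBath μ p₁)))).comap
            (fun hh : (j : ↥(Finset.Iic n)) → Bool × (Π j, X j) => hh ⟨n, Finset.mem_Iic.2 le_rfl⟩)
            (measurable_pi_apply _))),
        Tendsto (fun n : ℕ =>
            (∑ i ∈ range n, (targetLevel (Π j, X j)).indicator (1 : Bool × (Π j, X j) → ℝ) (x i)) / n)
          atTop (𝓝 (Real.sigmoid (c - ΔF))) ∧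
        Tendsto (fun n : ℕ => c - Real.log
            ((∑ i ∈ range n, (targetLevel (Π j, X j)).indicator (1 : Bool × (Π j, X j) → ℝ) (x i)) / n /
              (1 - (∑ i ∈ range n,
                (targetLevel (Π j, X j)).indicator (1 : Bool × (Π j, X j) → ℝ) (x i)) / n)))
          atTop (𝓝 ΔF) := by
  obtain ⟨-, hfin₀, -, -, h0, -, -, -⟩ := heatBathSweep_package (μ := μ) hp₀ hm₀0 hM₀ hmp₀ hpM₀ hl₀
  obtain ⟨-, hfin₁, -, -, -, -, -, -⟩ := heatBathSweep_package (μ := μ) hp₁ hm₁0 hM₁ hmp₁ hpM₁ hl₁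
  haveI := hfin₀
  haveI := hfin₁
  exact h.ncmc_heatBath_everyStart hp₀ hm₀0 hM₀ hmp₀ hpM₀ hl₀ hp₁ hm₁0 hM₁ hmp₁ hpM₁ hl₁ c
    (h.bind_work_ne_ne_zero_of_ne h0 hΔF hc) hΔF

/-- **CERTIFIED ERROR BARS FOR THE ENGINE'S NCMC CHAIN WITH HEAT-BATH SWEEPS.**  Same hypotheses:
there is an `ε ∈ (0, 1]` (explicit in the proof: rejection mass times `(m/M)^{|l|}`-type constants)
such that, with `σ = σ(c − ΔF)`: from ANY initial law `|E p̂_n − σ| ≤ 2/(ε n)`; in equilibrium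
`Var p̂_n ≤ 2 (1/2 + (2/ε − 1)/(1 − σ)) σ(1 − σ)/n` and
`P(|dF_occ,n − ΔF| ≥ η) ≤ that / δ_η²`, `δ_η = min(σ(c − ΔF + η) − σ, σ − σ(c − ΔF − η))`. -/
theorem CrooksPair.ncmc_heatBath_errorBars {p₀ p₁ : (Π j, X j) → ℝ≥0∞} {m₀ M₀ m₁ M₁ : ℝ≥0∞}
    (hp₀ : Measurable p₀) (hm₀0 : m₀ ≠ 0) (hM₀ : M₀ ≠ ∞) (hmp₀ : ∀ ω, m₀ ≤ p₀ ω)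
    (hpM₀ : ∀ ω, p₀ ω ≤ M₀) {l₀ : List ι} (hl₀ : ∀ i, i ∈ l₀)
    (hp₁ : Measurable p₁) (hm₁0 : m₁ ≠ 0) (hM₁ : M₁ ≠ ∞) (hmp₁ : ∀ ω, m₁ ≤ p₁ ω)
    (hpM₁ : ∀ ω, p₁ ω ≤ M₁) {l₁ : List ι} (hl₁ : ∀ i, i ∈ l₁)
    {E : Type*} [MeasurableSpace E] {κF κR : Kernel (Π j, X j) E} [IsMarkovKernel κF]
    [IsMarkovKernel κR] {s e : E → Π j, X j} {W : E → ℝ}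
    (h : CrooksPair ((Measure.pi μ).withDensity p₀) ((Measure.pi μ).withDensity p₁) κF κR s e W)
    (c : ℝ) (hW : (((Measure.pi μ).withDensity p₀).bind κF) {ε | W ε ≠ c} ≠ 0) {ΔF : ℝ}
    (hΔF : Real.exp (-ΔF) = ((((Measure.pi μ).withDensity p₀) univ)⁻¹ *
      ((Measure.pi μ).withDensity p₁) univ).toReal) :
    ∃ (_ : IsMarkovKernel (switchKernel κF κR c W s e))
      (_ : IsMarkovKernel (levelKernel (cycle (l₀.map (siteHeatBath μ p₀)))
        (cycle (l₁.map (siteHeatBath μ p₁)))))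
      (_ : IsFiniteMeasure ((Measure.pi μ).withDensity p₀))
      (_ : IsFiniteMeasure ((Measure.pi μ).withDensity p₁)) (ε : ℝ), 0 < ε ∧ ε ≤ 1 ∧
      (∀ (μ₀ : Measure (Bool × (Π j, X j))) [IsProbabilityMeasure μ₀] (n : ℕ), n ≠ 0 →
        |∫ x, (∑ i ∈ range n,
              (targetLevel (Π j, X j)).indicator (1 : Bool × (Π j, X j) → ℝ) (x i)) / n
            ∂(Kernel.trajMeasure (X := fun _ : ℕ => Bool × (Π j, X j)) μ₀
              (fun n : ℕ => (switchKernel κF κR c W s e ∘ₖ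
                levelKernel (cycle (l₀.map (siteHeatBath μ p₀)))
                  (cycle (l₁.map (siteHeatBath μ p₁)))).comap
                (fun hh : (j : ↥(Finset.Iic n)) → Bool × (Π j, X j) =>
                  hh ⟨n, Finset.mem_Iic.2 le_rfl⟩) (measurable_pi_apply _))) -
          Real.sigmoid (c - ΔF)| ≤ 2 / (ε * n)) ∧
      (∀ n : ℕ, n ≠ 0 →
        Var[fun z : ℕ → Bool × (Π j, X j) => (∑ i ∈ range n,
            (targetLevel (Π j, X j)).indicator (1 : Bool × (Π j, X j) → ℝ) (z i)) / n;
          Kernel.trajMeasure (X := fun _ : ℕ => Bool × (Π j, X j))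
            ((jointWeight c ((Measure.pi μ).withDensity p₀) ((Measure.pi μ).withDensity p₁) univ)⁻¹ •
              jointWeight c ((Measure.pi μ).withDensity p₀) ((Measure.pi μ).withDensity p₁))
            (fun n : ℕ => (switchKernel κF κR c W s e ∘ₖ
              levelKernel (cycle (l₀.map (siteHeatBath μ p₀)))
                (cycle (l₁.map (siteHeatBath μ p₁)))).comap
              (fun hh : (j : ↥(Finset.Iic n)) → Bool × (Π j, X j) =>
                hh ⟨n, Finset.mem_Iic.2 le_rfl⟩) (measurable_pi_apply _))] ≤
          2 * (1 / 2 + (2 / ε - 1) / (1 - Real.sigmoid (c - ΔF))) *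
            (Real.sigmoid (c - ΔF) * (1 - Real.sigmoid (c - ΔF))) / n) ∧
      (∀ n : ℕ, n ≠ 0 → ∀ η : ℝ, 0 < η →
        Kernel.trajMeasure (X := fun _ : ℕ => Bool × (Π j, X j))
            ((jointWeight c ((Measure.pi μ).withDensity p₀) ((Measure.pi μ).withDensity p₁) univ)⁻¹ •
              jointWeight c ((Measure.pi μ).withDensity p₀) ((Measure.pi μ).withDensity p₁))
            (fun n : ℕ => (switchKernel κF κR c W s e ∘ₖ
              levelKernel (cycle (l₀.map (siteHeatBath μ p₀)))
                (cycle (l₁.map (siteHeatBath μ p₁)))).comap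
              (fun hh : (j : ↥(Finset.Iic n)) → Bool × (Π j, X j) =>
                hh ⟨n, Finset.mem_Iic.2 le_rfl⟩) (measurable_pi_apply _))
          {z | η ≤ |c - Real.log
              ((∑ i ∈ range n,
                  (targetLevel (Π j, X j)).indicator (1 : Bool × (Π j, X j) → ℝ) (z i)) / n /
                (1 - (∑ i ∈ range n,
                  (targetLevel (Π j, X j)).indicator (1 : Bool × (Π j, X j) → ℝ) (z i)) / n)) - ΔF|} ≤
          ENNReal.ofReal (2 * (1 / 2 + (2 / ε - 1) / (1 - Real.sigmoid (c - ΔF))) *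
            (Real.sigmoid (c - ΔF) * (1 - Real.sigmoid (c - ΔF))) / n /
            (min (Real.sigmoid (c - ΔF + η) - Real.sigmoid (c - ΔF))
              (Real.sigmoid (c - ΔF) - Real.sigmoid (c - ΔF - η))) ^ 2)) := by
  obtain ⟨hMk₀, hfin₀, -, -, h0, -, hK₀, -⟩ := heatBathSweep_package (μ := μ) hp₀ hm₀0
    hM₀ hmp₀ hpM₀ hl₀
  obtain ⟨hMk₁, hfin₁, -, -, h1, -, hK₁, -⟩ := heatBathSweep_package (μ := μ) hp₁ hm₁0
    hM₁ hmp₁ hpM₁ hl₁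
  obtain ⟨hmfin₀, hm₀, hmin₀, hac₀⟩ := heatBath_minorising (μ := μ) hp₀ hm₀0 hM₀ hmp₀ hpM₀ hl₀
  obtain ⟨hmfin₁, hm₁, hmin₁, hac₁⟩ := heatBath_minorising (μ := μ) hp₁ hm₁0 hM₁ hmp₁ hpM₁ hl₁
  haveI := hMk₀
  haveI := hMk₁
  haveI := hfin₀
  haveI := hfin₁
  haveI := hmfin₀
  haveI := hmfin₁
  obtain ⟨ε, hε0, hε1, hA, hB, hC⟩ := h.ncmc_errorBars_of_exists_sq h0 h1 hK₀ hK₁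
    (h.ncmc_exists_sq_doeblin hm₀ hm₁ hmin₀ hmin₁ hac₀ hac₁ c hW) hΔF
  exact ⟨isMarkovKernel_switchKernel (κF := κF) (κR := κR) (c := c)
      h.measurable_W h.measurable_s h.measurable_e, isMarkovKernel_levelKernel _ _, hfin₀, hfin₁,
    ε, hε0, hε1, hA, hB, hC⟩

end HeatBath

end Summit.Ventures.LatticeQCDFlow.Exactness.GeneralNCMC
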